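import Literature.AlgebraicGeometry.Motives.HodgeGroupOfOrientationNondegenerate
import Literature.AlgebraicGeometry.Motives.MumfordTateGroupOfOrientationGenerators
import HarnessLib

/-!
# `MT(V^n_{(F,Π)})(ℂ)` is an INCREASING, INJECTIVE function of the module of translated degree vectors `W_Π = span{deg∘τ}`,
# and `Hg(V^n_{(F,Π)})(ℂ)` of `U_Π = span{2·deg∘τ − n}`: two oriented structures on the same field `F` — of any weights —
# have comparable / equal Mumford–Tate groups iff their modules are (GGK (V.D.4) «`Im(𝒩_{Π′}) = M_φ̃`» as an order statement)

[topic AlgebraicGeometry/Motives]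

Layer `Literature/AlgebraicGeometry/Motives`, lane `lit-hodgefound` (Track 2 foundations library; seat `lit-hodgefound-p02`, gen 27,
row g27-#6).  THEOREMS ONLY (no definition, no named fact; net debt `0`).  The HIGHER-WEIGHT twin of Part VI of p29's weight-one
`Motives/MumfordTateGroupOfCMTypeComplexPoints` (`mumfordTateGroupBaseChange_complex_ofCMType_le_iff_translateSpan_le`,
`hodgeGroupBaseChange_complex_ofCMType_le_iff_antiSpan_le`), followed LINE BY LINE with Dodson's `W_Φ = translateSpan` replaced by
`W_Π = degSpan Aut(ℂ) deg` and Shimura's `U_Φ = antiSpan` by `U_Π = antiDegSpan Aut(ℂ) n deg` (g25-#1 `OrientedTypeRank`); its private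
integer-duality engine is copied privately.  Inputs BY NAME: FILE 1 of g26-#2 `Motives/MumfordTateGroupOfOrientationComplexPoints`
(`MT(V^n_{(F,Π)})(ℂ)` is cut out by the characters orthogonal to `W_Π`; the cocharacter values `(z^{deg(τ•σ)})_σ` lie in it), FILE 2
`Motives/HodgeGroupOfOrientationComplexPoints` (`Hg` is cut out by the orientation-balanced characters), g27-#3
`Motives/MumfordTateGroupOfOrientationGenerators` (the conjugates of `h|_{U(1)}`, `(z^{2deg(τ•σ)−n})_σ`, lie in `Hg`), g27-#1
`Motives/HodgeGroupOfOrientationNondegenerate` (balanced ⟺ orthogonal to `U_Π`).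

THE PRINTS.  GGK [GreenGriffithsKerr2012] (V.D.4) p. 164: «`Im(N_{Π′}) = M_φ̃`» — the Mumford–Tate group of `V^n_{(F,Π)}` inside
`Res_{F/ℚ}𝔾_m` is a function of the Galois module generated by the cocharacter `μ_Π` alone, and an increasing one; §V.D p. 164: «If a
SCMpHS `(V,φ)` has a sub-Hodge structure then they will have the same Mumford–Tate group»; (V.D.7) p. 165 compares `M_{φ^n_{(F,Π)}}` with
the `M_{φ^1_{(F,Θ_i)}}` of the related types.  P. Deligne [Deligne1982HodgeCycles] I Ex. 3.7 (c) (weight one): «`Y(G)` is the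
`Gal(ℚ̄/ℚ)`-module generated by `μ`».  G. Shimura [Shimura1998] §32.10: `T(φ) ⊗ ℚ`, `T(φ − φρ) ⊗ ℚ`.

WHAT IS PROVED (`K` any number field; `Λ : Orientation K n`, `Λ' : Orientation K n'` two orientations OF THE SAME FIELD, any weights;
both Mumford–Tate groups live in `GL(ℂ ⊗ K)`, `[HodgeTensorFacts.{0,0}]`).
* §1 `forall_sum_mul_deg_smul_eq_zero_iff_forall_degSpan` (FILE 1's annihilator is the integer annihilator of `W_Π`),
  `forall_two_mul_sum_mul_deg_smul_eq_iff_forall_antiDegSpan` (FILE 2's balanced vectors are the integer annihilator of `U_Π`).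
* §2 **`mumfordTateGroupBaseChange_complex_ofOrientation_le_iff_degSpan_le`** (`MT(V_{Λ'})(ℂ) ≤ MT(V_Λ)(ℂ) ⟺ W_{Λ'} ≤ W_Λ`: monotone
  `…_le_of_degSpan_le` + injective `degSpan_le_of_…_le`), **`mumfordTateGroupBaseChange_complex_ofOrientation_eq_iff_degSpan_eq`**;
  **`hodgeGroupBaseChange_complex_ofOrientation_le_iff_antiDegSpan_le`**, **`hodgeGroupBaseChange_complex_ofOrientation_eq_iff_antiDegSpan_eq`**.
* §3 Weight one vs weight `n`: `degTranslate_ofCMType_eq_translateInd`, `degSpan_ofCMType_eq_translateSpan`,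
  **`mumfordTateGroupBaseChange_complex_ofCMType_le_ofOrientation_iff`** (`MT(V¹_{(F,Θ)})(ℂ) ≤ MT(V^n_{(F,Π)})(ℂ) ⟺ W_Θ ≤ W_Π`: when the
  Hodge structure of a type `Θ` — e.g. a W- or G-Jacobian — is «controlled» by `V^n_{(F,Π)}`),
  `mumfordTateGroupBaseChange_complex_ofOrientation_eq_ofCMType_iff` (same Mumford–Tate group iff `W_Π = W_Θ`).

HONEST SCOPE.  Order statements between POINT groups inside `GL(ℂ ⊗ K)` for two orientations of the SAME field `K`; no morphisms
of Hodge structures (sub-Hodge structures, tensor constructions, the half-twist embeddings of (V.D.2)) are formalised here, so GGK's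
«sub-Hodge structure ⟹ same `M`» and the surjections of (V.D.7) are NOT claimed — only their shadow on the modules `W`.

## References
* [GreenGriffithsKerr2012] M. Green, P. Griffiths, M. Kerr, *Mumford–Tate Groups and Domains: Their Geometry and Arithmetic*, Ann. of
  Math. Stud. 183 (2012): (V.D.4) p. 164, §V.D p. 164, (V.D.7) p. 165.
* [Deligne1982HodgeCycles] P. Deligne, *Hodge cycles on abelian varieties*, LNM 900 (1982), I Ex. 3.7 (c).
* [Shimura1998] G. Shimura, *Abelian Varieties with Complex Multiplication and Modular Functions* (1998), §32.7, §32.10.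
* [Dodson1987] B. Dodson, J. Algebra 111 (1987), §1.1 (p. 50).
-/

noncomputable section

open scoped TensorProduct Classical Pointwise
open Module NumberField

namespace Literature.AlgebraicGeometry.Motives

namespace HodgeStructure

open RealMult (embCoords embCoords_tmul)
open Literature.NumberTheory.ComplexMultiplication

/-! ## §0 Integer duality (private copy of p29's weight-one Part VI engine) -/

section Engine

/-- **Integer duality**: a rational vector outside a subspace `W ⊆ ℚ^E` is separated from `W` by an INTEGER functional `c`
(`Σ_σ c_σ w_σ = 0` on `W`, `Σ_σ c_σ y_σ ≠ 0`). [folklore] -/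
private theorem exists_int_dual_of_notMem_mono {E : Type} [Fintype E] [DecidableEq E] (W : Submodule ℚ (E → ℚ))
    {y : E → ℚ} (hy : y ∉ W) :
    ∃ c : E → ℤ, (∀ w ∈ W, ∑ σ, (c σ : ℚ) * w σ = 0) ∧ ∑ σ, (c σ : ℚ) * y σ ≠ 0 := by
  obtain ⟨f, hfy, hfW⟩ := W.exists_dual_map_eq_bot_of_notMem hy inferInstance
  obtain ⟨q, hq⟩ : ∃ q : E → ℚ, ∀ σ, q σ = f (Pi.single σ 1) := ⟨_, fun _ => rfl⟩
  have hf : ∀ v : E → ℚ, f v = ∑ σ, q σ * v σ := by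
    intro v
    conv_lhs => rw [← Finset.univ_sum_single v]
    rw [map_sum]
    refine Finset.sum_congr rfl fun σ _ => ?_
    have hs : (Pi.single σ (v σ) : E → ℚ) = v σ • (Pi.single σ (1 : ℚ) : E → ℚ) := by
      ext ρ
      simp [Pi.single_apply]
    rw [hs, map_smul, smul_eq_mul, mul_comm, hq]
  obtain ⟨D, hD⟩ : ∃ D : ℕ, D = ∏ σ, (q σ).den := ⟨_, rfl⟩
  have hD0 : (D : ℚ) ≠ 0 := by
    rw [hD, Nat.cast_prod]
    exact Finset.prod_ne_zero_iff.2 fun σ _ => Nat.cast_ne_zero.2 (q σ).den_nz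
  have hn : ∀ σ, (((q σ).num * ∏ σ' ∈ Finset.univ.erase σ, ((q σ').den : ℤ) : ℤ) : ℚ) = D * q σ := by
    intro σ
    have h1 : (D : ℚ) = (q σ).den * ∏ σ' ∈ Finset.univ.erase σ, ((q σ').den : ℚ) := by
      rw [hD, Nat.cast_prod, Finset.mul_prod_erase Finset.univ (fun σ' => ((q σ').den : ℚ)) (Finset.mem_univ σ)]
    have h2 : ((q σ).den : ℚ) * q σ = (q σ).num := by
      rw [mul_comm]
      exact Rat.mul_den_eq_num (q σ)
    rw [h1, Int.cast_mul, Int.cast_prod]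
    simp only [Int.cast_natCast]
    rw [mul_right_comm, h2]
  refine ⟨fun σ => (q σ).num * ∏ σ' ∈ Finset.univ.erase σ, ((q σ').den : ℤ), fun w hw => ?_, ?_⟩
  · have hw0 : f w = 0 := by
      have h := Submodule.mem_map_of_mem (f := f) hw
      rwa [hfW, Submodule.mem_bot] at h
    calc ∑ σ, (((q σ).num * ∏ σ' ∈ Finset.univ.erase σ, ((q σ').den : ℤ) : ℤ) : ℚ) * w σ
        = ∑ σ, (D : ℚ) * (q σ * w σ) := Finset.sum_congr rfl fun σ _ => by rw [hn, mul_assoc]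
      _ = D * f w := by rw [← Finset.mul_sum, ← hf w]
      _ = 0 := by rw [hw0, mul_zero]
  · calc ∑ σ, (((q σ).num * ∏ σ' ∈ Finset.univ.erase σ, ((q σ').den : ℤ) : ℤ) : ℚ) * y σ
        = ∑ σ, (D : ℚ) * (q σ * y σ) := Finset.sum_congr rfl fun σ _ => by rw [hn, mul_assoc]
      _ = D * f y := by rw [← Finset.mul_sum, ← hf y]
      _ ≠ 0 := mul_ne_zero hD0 hfy

/-- `2^k = 1` in `ℂ` forces `k = 0`. [folklore] -/
private theorem eq_zero_of_two_zpow_eq_one_mono {k : ℤ} (h : (2 : ℂ) ^ k = 1) : k = 0 := by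
  have hC : (((2 : ℝ) ^ k : ℝ) : ℂ) = ((1 : ℝ) : ℂ) := by
    rw [Complex.ofReal_zpow, Complex.ofReal_one, Complex.ofReal_ofNat]
    exact h
  have hR : (2 : ℝ) ^ k = (2 : ℝ) ^ (0 : ℤ) := by
    rw [zpow_zero]
    exact Complex.ofReal_injective hC
  exact zpow_right_injective₀ (by norm_num) (by norm_num) hR

end Engine

variable {K : Type} [Field K] [NumberField K] {n n' : ℤ} (Λ : Orientation K n) (Λ' : Orientation K n')

/-! ## §1 The annihilators of FILE 1 / FILE 2 are the integer annihilators of `W_Π` and `U_Π` -/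

/-- **FILE 1's annihilator is the integer annihilator of `W_Π = degSpan Aut(ℂ) deg`**: an integer vector is orthogonal to all translated
degree vectors iff the functional `Σ_σ c_σ (·)_σ` vanishes on `W_Π`.  Weight one: p29's
`forall_sum_mul_indicator_smul_eq_zero_iff_forall_translateSpan`. [cite: GreenGriffithsKerr2012, (V.A.7) p. 157 and (V.D.4) p. 164]
[cite: Dodson1987, §1.1 (p. 50)] -/
theorem forall_sum_mul_deg_smul_eq_zero_iff_forall_degSpan (c : (K →+* ℂ) → ℤ) :
    (∀ τ : ℂ ≃+* ℂ, ∑ σ, c σ * Λ.deg (τ • σ) = 0) ↔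
      ∀ w ∈ degSpan (ℂ ≃+* ℂ) Λ.deg, ∑ σ, (c σ : ℚ) * w σ = 0 := by
  constructor
  · intro h w hw
    induction hw using Submodule.span_induction with
    | mem u hu =>
      obtain ⟨τ, rfl⟩ := hu
      exact (sum_mul_deg_smul_eq_zero_iff_sum_mul_degTranslate_eq_zero Λ c τ).1 (h τ)
    | zero => simp
    | add u v _ _ hu hv => simp only [Pi.add_apply, mul_add, Finset.sum_add_distrib, hu, hv, add_zero]
    | smul a u _ hu =>
      simp only [Pi.smul_apply, smul_eq_mul, mul_left_comm _ a, ← Finset.mul_sum, hu, mul_zero]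
  · intro h τ
    exact (sum_mul_deg_smul_eq_zero_iff_sum_mul_degTranslate_eq_zero Λ c τ).2 (h _ (degTranslate_mem_degSpan Λ.deg τ))

/-- **FILE 2's orientation-balanced vectors are the integer annihilator of `U_Π = antiDegSpan Aut(ℂ) n deg`** (g27-#1
`forall_two_mul_sum_mul_degTranslate_eq_iff` through the cast bridge).  Weight one: p29's `forall_two_mul_sum_eq_sum_iff_forall_antiSpan`.
[cite: GreenGriffithsKerr2012, (V.A.7) p. 157] [cite: Shimura1998, §32.10] -/
theorem forall_two_mul_sum_mul_deg_smul_eq_iff_forall_antiDegSpan (c : (K →+* ℂ) → ℤ) :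
    (∀ τ : ℂ ≃+* ℂ, 2 * ∑ σ, c σ * Λ.deg (τ • σ) = n * ∑ σ, c σ) ↔
      ∀ w ∈ antiDegSpan (ℂ ≃+* ℂ) n Λ.deg, ∑ σ, (c σ : ℚ) * w σ = 0 := by
  rw [forall_two_mul_sum_mul_deg_smul_eq_iff_rat Λ c, forall_two_mul_sum_mul_degTranslate_eq_iff (ℂ ≃+* ℂ) Λ.deg n]

variable [HodgeTensorFacts.{0, 0}]

/-! ## §2 Monotone and injective -/

/-- **Monotonicity (`MT`)**: `W_{Λ'} ≤ W_Λ ⟹ MT(V_{Λ'})(ℂ) ≤ MT(V_Λ)(ℂ)` — a larger module of translated degree vectors has a smaller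
annihilator, hence (FILE 1) cuts out a larger torus.  Any two weights. [cite: GreenGriffithsKerr2012, (V.D.4) p. 164]
[cite: Deligne1982HodgeCycles, I Example 3.7 (c)] -/
theorem mumfordTateGroupBaseChange_complex_ofOrientation_le_of_degSpan_le
    (h : degSpan (ℂ ≃+* ℂ) Λ'.deg ≤ degSpan (ℂ ≃+* ℂ) Λ.deg) :
    (ofOrientation Λ').mumfordTateGroupBaseChange ℂ ≤ (ofOrientation Λ).mumfordTateGroupBaseChange ℂ := by
  intro γ hγ
  refine mem_mumfordTateGroupBaseChange_ofOrientation_of_forall_prod_embCoords_zpow_eq_one Λ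
    (mumfordTateGroupBaseChange_ofOrientation_apply ℂ Λ' hγ) fun c hc => ?_
  refine prod_embCoords_zpow_eq_one_of_mem_mumfordTateGroupBaseChange_ofOrientation Λ' hγ c ?_
  rw [forall_sum_mul_deg_smul_eq_zero_iff_forall_degSpan] at hc ⊢
  exact fun w hw => hc w (h hw)

/-- **Monotonicity (`Hg`)**: `U_{Λ'} ≤ U_Λ ⟹ Hg(V_{Λ'})(ℂ) ≤ Hg(V_Λ)(ℂ)` (FILE 2). [cite: GreenGriffithsKerr2012, §I.B (I.B.1) and (V.D.4) p. 164]
[cite: Shimura1998, §32.10] -/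
theorem hodgeGroupBaseChange_complex_ofOrientation_le_of_antiDegSpan_le
    (h : antiDegSpan (ℂ ≃+* ℂ) n' Λ'.deg ≤ antiDegSpan (ℂ ≃+* ℂ) n Λ.deg) :
    (ofOrientation Λ').hodgeGroupBaseChange ℂ ≤ (ofOrientation Λ).hodgeGroupBaseChange ℂ := by
  intro γ hγ
  refine mem_hodgeGroupBaseChange_ofOrientation_of_forall_prod_embCoords_zpow_eq_one Λ
    (hodgeGroupBaseChange_ofOrientation_apply ℂ Λ' hγ) fun c hc => ?_
  refine prod_embCoords_zpow_eq_one_of_mem_hodgeGroupBaseChange_ofOrientation Λ' hγ c ?_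
  rw [forall_two_mul_sum_mul_deg_smul_eq_iff_forall_antiDegSpan] at hc ⊢
  exact fun w hw => hc w (h hw)

/-- **Injectivity (`MT`)**: `MT(V_{Λ'})(ℂ) ≤ MT(V_Λ)(ℂ) ⟹ W_{Λ'} ≤ W_Λ` — the cocharacter value `(2^{deg′(τ•σ)})_σ ∈ MT(V_{Λ'})(ℂ)` (FILE 1
§4) is then killed by every integer vector orthogonal to `W_Λ`, i.e. `2^{⟨c, deg′∘τ⟩} = 1`, so `deg′∘τ` is orthogonal to the integer
annihilator of `W_Λ`, hence lies in `W_Λ` (integer duality). [cite: GreenGriffithsKerr2012, (V.D.4) p. 164 and §V.F p. 173]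
[cite: Deligne1982HodgeCycles, I Example 3.7 (c)] -/
theorem degSpan_le_of_mumfordTateGroupBaseChange_complex_ofOrientation_le
    (h : (ofOrientation Λ').mumfordTateGroupBaseChange ℂ ≤ (ofOrientation Λ).mumfordTateGroupBaseChange ℂ) :
    degSpan (ℂ ≃+* ℂ) Λ'.deg ≤ degSpan (ℂ ≃+* ℂ) Λ.deg := by
  rw [degSpan, Submodule.span_le]
  rintro _ ⟨τ, rfl⟩
  rw [SetLike.mem_coe]
  by_contra hy
  obtain ⟨c, hcW, hcy⟩ := exists_int_dual_of_notMem_mono (degSpan (ℂ ≃+* ℂ) Λ.deg) hy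
  have hc : ∀ τ' : ℂ ≃+* ℂ, ∑ σ, c σ * Λ.deg (τ' • σ) = 0 :=
    (forall_sum_mul_deg_smul_eq_zero_iff_forall_degSpan Λ c).2 hcW
  obtain ⟨γ, hγ, hγ1⟩ := exists_mem_mumfordTateGroupBaseChange_ofOrientation_embCoords_apply_one_eq_zpow_deg_smul Λ' τ
    (Units.mk0 (2 : ℂ) two_ne_zero)
  have hprod := prod_embCoords_zpow_eq_one_of_mem_mumfordTateGroupBaseChange_ofOrientation Λ (h hγ) c hc
  rw [Finset.prod_congr rfl fun σ _ => by rw [hγ1 σ], Units.val_mk0, prod_zpow_deg_smul_zpow Λ' τ two_ne_zero c] at hprod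
  have hk := eq_zero_of_two_zpow_eq_one_mono hprod
  exact hcy ((sum_mul_deg_smul_eq_zero_iff_sum_mul_degTranslate_eq_zero Λ' c τ).1 hk)

/-- **Injectivity (`Hg`)**: `Hg(V_{Λ'})(ℂ) ≤ Hg(V_Λ)(ℂ) ⟹ U_{Λ'} ≤ U_Λ`, via the anti-symmetrised cocharacter value `(2^{2deg′(τ•σ)−n′})_σ ∈
Hg(V_{Λ'})(ℂ)` (g27-#3) and `2^{⟨c, 2·deg′∘τ − n′⟩} = 1`. [cite: Shimura1998, §32.10] [cite: GreenGriffithsKerr2012, §I.B (I.B.1)] -/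
theorem antiDegSpan_le_of_hodgeGroupBaseChange_complex_ofOrientation_le
    (h : (ofOrientation Λ').hodgeGroupBaseChange ℂ ≤ (ofOrientation Λ).hodgeGroupBaseChange ℂ) :
    antiDegSpan (ℂ ≃+* ℂ) n' Λ'.deg ≤ antiDegSpan (ℂ ≃+* ℂ) n Λ.deg := by
  rw [antiDegSpan, Submodule.span_le]
  rintro _ ⟨τ, rfl⟩
  rw [SetLike.mem_coe]
  by_contra hy
  obtain ⟨c, hcU, hcy⟩ := exists_int_dual_of_notMem_mono (antiDegSpan (ℂ ≃+* ℂ) n Λ.deg) hy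
  have hc : ∀ τ' : ℂ ≃+* ℂ, 2 * ∑ σ, c σ * Λ.deg (τ' • σ) = n * ∑ σ, c σ :=
    (forall_two_mul_sum_mul_deg_smul_eq_iff_forall_antiDegSpan Λ c).2 hcU
  obtain ⟨γ, hγ, hγ1⟩ := exists_mem_hodgeGroupBaseChange_ofOrientation_embCoords_apply_one_eq_zpow_two_mul_deg_sub Λ' τ
    (Units.mk0 (2 : ℂ) two_ne_zero)
  have hprod := prod_embCoords_zpow_eq_one_of_mem_hodgeGroupBaseChange_ofOrientation Λ (h hγ) c hc
  rw [Finset.prod_congr rfl fun σ _ => by rw [hγ1 σ], Units.val_mk0, prod_zpow_two_mul_deg_sub_zpow Λ' τ two_ne_zero c] at hprod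
  have hk := eq_zero_of_two_zpow_eq_one_mono hprod
  refine hcy ?_
  rw [sum_mul_antiDegVec, sub_eq_zero]
  have hcast : ((2 * ∑ σ, c σ * Λ'.deg (τ • σ) - n' * ∑ σ, c σ : ℤ) : ℚ) =
      2 * ∑ σ, (c σ : ℚ) * degTranslate Λ'.deg τ σ - n' * ∑ σ, (c σ : ℚ) := by
    simp only [degTranslate_apply]
    push_cast
    ring
  have h0 : (2 * ∑ σ, (c σ : ℚ) * degTranslate Λ'.deg τ σ - n' * ∑ σ, (c σ : ℚ)) = 0 := by
    rw [← hcast, hk, Int.cast_zero]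
  exact sub_eq_zero.1 h0

/-- **(V.D.4) as an order statement: `MT(V_{Λ'})(ℂ) ≤ MT(V_Λ)(ℂ) ⟺ W_{Λ'} ≤ W_Λ`** — on `ℂ`-points the Mumford–Tate group of the SCMpHS of an
oriented field is an increasing, injective function of the module of translated degree vectors `W_Π = degSpan Aut(ℂ) deg` (of
dimension `𝓡(F,Π) = dim M_φ̃`), for two orientations of the same field of any two weights.  Weight one: p29's
`mumfordTateGroupBaseChange_complex_ofCMType_le_iff_translateSpan_le`. [cite: GreenGriffithsKerr2012, (V.D.4) p. 164] [cite: Deligne1982HodgeCycles, I Example 3.7 (c)] -/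
theorem mumfordTateGroupBaseChange_complex_ofOrientation_le_iff_degSpan_le :
    (ofOrientation Λ').mumfordTateGroupBaseChange ℂ ≤ (ofOrientation Λ).mumfordTateGroupBaseChange ℂ ↔
      degSpan (ℂ ≃+* ℂ) Λ'.deg ≤ degSpan (ℂ ≃+* ℂ) Λ.deg :=
  ⟨degSpan_le_of_mumfordTateGroupBaseChange_complex_ofOrientation_le Λ Λ',
    mumfordTateGroupBaseChange_complex_ofOrientation_le_of_degSpan_le Λ Λ'⟩

/-- **`MT(V_Λ)(ℂ) = MT(V_{Λ'})(ℂ) ⟺ W_Λ = W_{Λ'}`**: two oriented structures on the same field have the same Mumford–Tate group (inside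
`GL(ℂ ⊗ F)`) iff their translated degree vectors span the same module — e.g. `Π` and `Π̄`, `Π` and a Tate twist of `Π` (`n ≠ 0`), `Π` and
its reflex-type conjugates. [cite: GreenGriffithsKerr2012, (V.D.4) p. 164] [cite: Deligne1982HodgeCycles, I Example 3.7 (c)] -/
theorem mumfordTateGroupBaseChange_complex_ofOrientation_eq_iff_degSpan_eq :
    (ofOrientation Λ).mumfordTateGroupBaseChange ℂ = (ofOrientation Λ').mumfordTateGroupBaseChange ℂ ↔
      degSpan (ℂ ≃+* ℂ) Λ.deg = degSpan (ℂ ≃+* ℂ) Λ'.deg := by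
  constructor
  · intro h
    exact le_antisymm (degSpan_le_of_mumfordTateGroupBaseChange_complex_ofOrientation_le Λ' Λ h.le)
      (degSpan_le_of_mumfordTateGroupBaseChange_complex_ofOrientation_le Λ Λ' h.ge)
  · intro h
    exact le_antisymm (mumfordTateGroupBaseChange_complex_ofOrientation_le_of_degSpan_le Λ' Λ h.le)
      (mumfordTateGroupBaseChange_complex_ofOrientation_le_of_degSpan_le Λ Λ' h.ge)

/-- **`Hg(V_{Λ'})(ℂ) ≤ Hg(V_Λ)(ℂ) ⟺ U_{Λ'} ≤ U_Λ`** (the Hodge group on `ℂ`-points is an increasing, injective function of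
`U_Π = antiDegSpan Aut(ℂ) n deg`, of dimension `𝓡 − 1 = dim M_φ`).  Weight one: p29's `hodgeGroupBaseChange_complex_ofCMType_le_iff_antiSpan_le`.
[cite: Shimura1998, §32.10] [cite: GreenGriffithsKerr2012, §I.B (I.B.1) and §V.D p. 164] -/
theorem hodgeGroupBaseChange_complex_ofOrientation_le_iff_antiDegSpan_le :
    (ofOrientation Λ').hodgeGroupBaseChange ℂ ≤ (ofOrientation Λ).hodgeGroupBaseChange ℂ ↔
      antiDegSpan (ℂ ≃+* ℂ) n' Λ'.deg ≤ antiDegSpan (ℂ ≃+* ℂ) n Λ.deg :=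
  ⟨antiDegSpan_le_of_hodgeGroupBaseChange_complex_ofOrientation_le Λ Λ',
    hodgeGroupBaseChange_complex_ofOrientation_le_of_antiDegSpan_le Λ Λ'⟩

/-- **`Hg(V_Λ)(ℂ) = Hg(V_{Λ'})(ℂ) ⟺ U_Λ = U_{Λ'}`**. [cite: Shimura1998, §32.10] [cite: GreenGriffithsKerr2012, §I.B (I.B.1)] -/
theorem hodgeGroupBaseChange_complex_ofOrientation_eq_iff_antiDegSpan_eq :
    (ofOrientation Λ).hodgeGroupBaseChange ℂ = (ofOrientation Λ').hodgeGroupBaseChange ℂ ↔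
      antiDegSpan (ℂ ≃+* ℂ) n Λ.deg = antiDegSpan (ℂ ≃+* ℂ) n' Λ'.deg := by
  constructor
  · intro h
    exact le_antisymm (antiDegSpan_le_of_hodgeGroupBaseChange_complex_ofOrientation_le Λ' Λ h.le)
      (antiDegSpan_le_of_hodgeGroupBaseChange_complex_ofOrientation_le Λ Λ' h.ge)
  · intro h
    exact le_antisymm (hodgeGroupBaseChange_complex_ofOrientation_le_of_antiDegSpan_le Λ' Λ h.le)
      (hodgeGroupBaseChange_complex_ofOrientation_le_of_antiDegSpan_le Λ Λ' h.ge)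

/-! ## §3 Weight one versus weight `n`: `MT(V¹_{(F,Θ)})` against `MT(V^n_{(F,Π)})` -/

omit [NumberField K] [HodgeTensorFacts.{0, 0}] in
/-- The translated degree vector of the `1`-orientation of a CM type is the tree's translate indicator `𝟙_{τ⁻¹Θ}`.
[cite: GreenGriffithsKerr2012, §V.A p. 154 («a type of F is just an effective 1-orientation»)] [cite: Dodson1987, §1.1 (p. 50)] -/
theorem degTranslate_ofCMType_eq_translateInd (Θ : CMType K) (τ : ℂ ≃+* ℂ) :
    degTranslate (Orientation.ofCMType Θ).deg τ = translateInd Θ.1 τ := by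
  funext σ
  rw [degTranslate_apply]
  by_cases h : τ • σ ∈ Θ.1
  · rw [Orientation.ofCMType_deg_of_mem Θ h, translateInd_of_mem h, Int.cast_one]
  · rw [Orientation.ofCMType_deg_of_not_mem Θ h, translateInd_of_not_mem h, Int.cast_zero]

omit [NumberField K] [HodgeTensorFacts.{0, 0}] in
/-- `W_{Π(Θ)} = W_Θ`: the module of the `1`-orientation of a CM type is Dodson's `translateSpan`.
[cite: Dodson1987, §1.1 (p. 50)] [cite: GreenGriffithsKerr2012, (V.A.7) p. 157] -/
theorem degSpan_ofCMType_eq_translateSpan (Θ : CMType K) :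
    degSpan (ℂ ≃+* ℂ) (Orientation.ofCMType Θ).deg = translateSpan (ℂ ≃+* ℂ) Θ.1 := by
  rw [degSpan, translateSpan]
  exact congrArg _ (congrArg Set.range (funext fun τ => degTranslate_ofCMType_eq_translateInd Θ τ))

/-- **`MT(V¹_{(F,Θ)})(ℂ) ≤ MT(V^n_{(F,Π)})(ℂ) ⟺ W_Θ ≤ W_Π`**: the Mumford–Tate group of the Hodge structure of a CM type `Θ` of `F` (a
CM abelian variety up to isogeny, e.g. a W- or G-Jacobian of `V^n_{(F,Π)}`) lies in that of `V^n_{(F,Π)}` — inside `GL(ℂ ⊗ F)` — iff every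
translate indicator `𝟙_{τ⁻¹Θ}` is a rational combination of translated degree vectors of `Π` (the module-level shadow of the surjections
`M_{φ^n_{(F,Π)}} ↠ M_{φ^1_{(F,Θ_i)}}` discussed in (V.D.7)). [cite: GreenGriffithsKerr2012, (V.D.7) p. 165 and (V.D.4) p. 164]
[cite: Deligne1982HodgeCycles, I Example 3.7 (c)] -/
theorem mumfordTateGroupBaseChange_complex_ofCMType_le_ofOrientation_iff (Θ : CMType K) :
    (ofCMType Θ).mumfordTateGroupBaseChange ℂ ≤ (ofOrientation Λ).mumfordTateGroupBaseChange ℂ ↔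
      translateSpan (ℂ ≃+* ℂ) Θ.1 ≤ degSpan (ℂ ≃+* ℂ) Λ.deg := by
  rw [← ofOrientation_ofCMType, mumfordTateGroupBaseChange_complex_ofOrientation_le_iff_degSpan_le, degSpan_ofCMType_eq_translateSpan]

/-- **`MT(V^n_{(F,Π)})(ℂ) = MT(V¹_{(F,Θ)})(ℂ) ⟺ W_Π = W_Θ`**: the SCMpHS `V^n_{(F,Π)}` and the Hodge structure of a CM type `Θ` of the same
field have THE SAME Mumford–Tate group iff their modules agree (then `𝓡(F,Π) = Rank(Θ)`). [cite: GreenGriffithsKerr2012, (V.D.7) p. 165 and (V.D.4) p. 164]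
[cite: Deligne1982HodgeCycles, I Example 3.7 (c)] -/
theorem mumfordTateGroupBaseChange_complex_ofOrientation_eq_ofCMType_iff (Θ : CMType K) :
    (ofOrientation Λ).mumfordTateGroupBaseChange ℂ = (ofCMType Θ).mumfordTateGroupBaseChange ℂ ↔
      degSpan (ℂ ≃+* ℂ) Λ.deg = translateSpan (ℂ ≃+* ℂ) Θ.1 := by
  rw [← ofOrientation_ofCMType, mumfordTateGroupBaseChange_complex_ofOrientation_eq_iff_degSpan_eq, degSpan_ofCMType_eq_translateSpan]

end HodgeStructure

end Literature.AlgebraicGeometry.Motives
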